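import Summits.QuantumFields.YangMills.Theorems.IR.Negative.TypShellCondFalseAllG.Laplace

/-!
# Crux `IR` (stmt-QuantumFields-19354) — the fixed-mesh negative for format T and the onset floor FOR EVERY COMPACT
# GAUGE GROUP, part 2/8: g5 §1∕§3 the rim-top twist geometry (section `Geometry5`)

Re-homed VERBATIM (statements, proofs, names; namespace `…Cruxes.IR.CruxIdea2g6` ↦ `…Cruxes.IR.FixedMeshAllG`) from the crux
workfile `Cruxes/IR/CruxIdea2FrameRowAllG.lean` rev 2 (sha16 81bea4c546c46a61; author `ym-cruxidea-19354-2` GEN 6) per owner R88,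
split by its sections into eight ≤ 400-line modules chained by import; credit docstring of record in the headline module
`Theorems/IR/Negative/TypShellCondFalseAllG.lean` (part 8/8).  Negative knowledge for stmt-QuantumFields-19354; closes no stub.
-/

set_option autoImplicit false

noncomputable section

open MeasureTheory Filter Topology
open Literature.MathematicalPhysics.QuantumLattice
open Literature.Probability.LatticeModels
open Summit.QuantumFields.YangMills.Cruxes.IR.Tempered (cellEdges windowCells regionEdges)
open Summit.QuantumFields.YangMills.Cruxes.IR.ShellTempered (windowCellsPlus)
open Summit.QuantumFields.YangMills.Cruxes.IR.OnsetFormats (TypShellCond shellCount)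
open Summit.QuantumFields.YangMills.Cruxes.IR.FixedMesh

namespace Summit.QuantumFields.YangMills.Cruxes.IR.FixedMeshAllG

/-! ## g5 §1∕§3 (copied verbatim from `Cruxes/IR/CruxIdea2FrameRow.lean` 7720daf266c53c8b): the rim-top twist -/

section Geometry5

variable {G : Type} [Group G]

/-- The RIM-TOP TWIST: right-multiply every vertical link based at height `b` (from `b` to `b+1`) by
`(k (upper endpoint))⁻¹`; `k : Site 4 → G` is an arbitrary site function (read only on the site layer `b + 1`). -/
def topTwist (b : ℕ) (k : Site 4 → G) (U : LGConfig 4 G) : LGConfig 4 G :=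
  fun e => if e.2 = 0 ∧ e.1 0 = (b : ℤ) then U e * (k (e.1 + Pi.single (0 : Fin 4) 1))⁻¹ else U e

/-- The layer gauge function: `k` on the site layer `x 0 = b + 1`, `1` elsewhere. -/
def layerGauge (b : ℕ) (k : Site 4 → G) : Site 4 → G :=
  fun x => if x 0 = (b : ℤ) + 1 then k x else 1

/-- Workfile theorem `add_single_apply_zero` (cruxidea-2 g6, `CruxIdea2FrameRowAllG.lean` rev 2, re-homed verbatim;
see the module docstring). -/
theorem add_single_apply_zero (x : Site 4) (i : Fin 4) :
    ((x + Pi.single i (1 : ℤ) : Site 4)) 0 = x 0 + if i = 0 then 1 else 0 := by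
  simp only [Pi.add_apply, Pi.single_apply]
  by_cases h : i = 0
  · subst h; simp
  · have h' : (0 : Fin 4) ≠ i := fun h0 => h h0.symm
    simp [h, h']

/-- **PROVED.** On every edge based at height `≤ b` the rim-top twist IS the gauge transformation by `layerGauge b k`. -/
theorem gaugeTransformZd_layerGauge_apply {b : ℕ} (k : Site 4 → G) (U : LGConfig 4 G) {e : ZdEdge 4}
    (he : e.1 0 ≤ (b : ℤ)) : gaugeTransformZd (layerGauge b k) U e = topTwist b k U e := by
  have h1 : layerGauge b k e.1 = 1 := by
    unfold layerGauge; rw [if_neg]; omega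
  unfold gaugeTransformZd topTwist
  rw [h1, one_mul]
  have h0 := add_single_apply_zero e.1 e.2
  by_cases hi : e.2 = 0
  · by_cases hb : e.1 0 = (b : ℤ)
    · have hmem : ((e.1 + Pi.single e.2 (1 : ℤ) : Site 4)) 0 = (b : ℤ) + 1 := by rw [h0, if_pos hi, hb]
      rw [if_pos ⟨hi, hb⟩]
      unfold layerGauge; rw [if_pos hmem, hi]
    · have hnm : ((e.1 + Pi.single e.2 (1 : ℤ) : Site 4)) 0 ≠ (b : ℤ) + 1 := by rw [h0, if_pos hi]; omega
      rw [if_neg (fun h => hb h.2)]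
      unfold layerGauge; rw [if_neg hnm, inv_one, mul_one]
  · have hnm : ((e.1 + Pi.single e.2 (1 : ℤ) : Site 4)) 0 ≠ (b : ℤ) + 1 := by rw [h0, if_neg hi]; omega
    rw [if_neg (fun h => hi h.1)]
    unfold layerGauge; rw [if_neg hnm, inv_one, mul_one]

/-- **PROVED.** Off the link layer `b` the twist changes nothing. -/
theorem topTwist_apply_of_ne {b : ℕ} (k : Site 4 → G) (U : LGConfig 4 G) {e : ZdEdge 4}
    (he : e.1 0 ≠ (b : ℤ)) : topTwist b k U e = U e := by
  unfold topTwist; rw [if_neg (fun h => he h.2)]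

/-- Heights of the edges of a cell of the standard frame. -/
theorem base_height_of_mem_cellEdges {b : ℕ} {c : Fin 4 → ℤ} {e : ZdEdge 4}
    (he : e ∈ cellEdges (stdFrame b) c) :
    (b : ℤ) * c 0 + 1 ≤ e.1 0 ∧ e.1 0 < (b : ℤ) * (c 0 + 1) + 1 := by
  have h := Fintype.mem_piFinset.1 (Finset.mem_product.1 he).1 0
  have h' := Finset.mem_Ico.1 h
  simp only [stdFrame, if_true] at h'
  exact h'

/-- **PROVED.** On every cell of the ROW LAYER (`c 0 = 0`: edges based at heights `1 … b`) the twist is the layer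
gauge transformation — the typicality of the frozen RIM cells transfers by gauge invariance. -/
theorem topTwist_eq_gauge_on_rowLayer {b : ℕ} (k : Site 4 → G) (U : LGConfig 4 G) {c : Fin 4 → ℤ}
    (hc : c 0 = 0) : ∀ e ∈ cellEdges (stdFrame b) c,
      topTwist b k U e = gaugeTransformZd (layerGauge b k) U e := by
  intro e he
  have h := base_height_of_mem_cellEdges he
  rw [hc] at h
  exact (gaugeTransformZd_layerGauge_apply k U (by linarith [h.2])).symm

/-- **PROVED.** On every cell OFF the row layer (`c 0 ≠ 0`) the twist is the identity (`1 ≤ b`). -/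
theorem topTwist_eq_self_off_rowLayer {b : ℕ} (hb : 1 ≤ b) (k : Site 4 → G) (U : LGConfig 4 G)
    {c : Fin 4 → ℤ} (hc : c 0 ≠ 0) : ∀ e ∈ cellEdges (stdFrame b) c, topTwist b k U e = U e := by
  intro e he
  have h := base_height_of_mem_cellEdges he
  refine topTwist_apply_of_ne k U fun heq => ?_
  have hb' : (1 : ℤ) ≤ b := by exact_mod_cast hb
  rcases lt_or_gt_of_ne hc with hlt | hgt
  · have : (b : ℤ) * (c 0 + 1) ≤ 0 := by nlinarith
    omega
  · have : (b : ℤ) ≤ (b : ℤ) * c 0 := by nlinarith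
    omega

/-- **PROVED (the admissibility of the pair).** The (i_T) agreement hypothesis at `Y = rowCells n`: on the window cells
off the row, `ζ` and `topTwist b k ζ` agree edge by edge (the plates are NOT conjugated). -/
theorem topTwist_agree_off_row {b n : ℕ} (hb : 1 ≤ b) (k : Site 4 → G) (ζ : LGConfig 4 G) :
    ∀ c ∈ windowCellsPlus n, c ∉ rowCells n → c ∈ windowCells n →
      ∀ e ∈ cellEdges (stdFrame b) c, ζ e = topTwist b k ζ e := by
  intro c _ hcr hcw e he
  have hc0 : c 0 ≠ 0 := fun h => hcr (Finset.mem_filter.2 ⟨hcw, h⟩)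
  exact (topTwist_eq_self_off_rowLayer hb k ζ hc0 e he).symm

/-- **PROVED (sanity anchor).** For a CONSTANT CENTRAL `g₀` the rim-top twist is the tree's layer twist at layer `b`
by `g₀⁻¹` — the present chain then IS the landed central chain (cruxidea-8) read at the top layer. -/
theorem topTwist_const_eq_layerTwist {g₀ : G} (hg : g₀ ∈ Subgroup.center G) (b : ℕ) :
    topTwist b (fun _ => g₀) = layerTwist (b : ℤ) g₀⁻¹ := by
  funext U e
  unfold topTwist layerTwist
  by_cases h : e.2 = 0 ∧ e.1 0 = (b : ℤ)
  · rw [if_pos h, if_pos h]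
    have hg' : g₀⁻¹ ∈ Subgroup.center G := Subgroup.inv_mem _ hg
    show U e * g₀⁻¹ = g₀⁻¹ * U e
    exact Subgroup.mem_center_iff.1 hg' (U e)
  · rw [if_neg h, if_neg h]

/-- The TOP RUN of the staple: `A(ζ) = ζ(top₀) ⋯ ζ(top_{m-1})` at height `b + 1` (frozen upper-plate links). -/
def topRun (b m : ℕ) (ζ : LGConfig 4 G) : G :=
  ((List.range m).map fun s : ℕ => ζ (site2 ((b : ℤ) + 1) s, 1)).prod

/-- **PROVED.** The twist leaves the top run, the bottom run, the closing link and the lower rim links alone and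
replaces the rim's top link `ζ(b,m)` by `ζ(b,m) · k(b+1,m)⁻¹`; hence the twisted staple is the untwisted one
LEFT-multiplied by the `A`-conjugate of the corner value `k (site2 (b+1) m)`. -/
theorem staple_topTwist {b : ℕ} (hb : 1 ≤ b) (m : ℕ) (k : Site 4 → G) (ζ : LGConfig 4 G) :
    staple b m (topTwist b k ζ) =
      topRun b m ζ * k (site2 ((b : ℤ) + 1) m) * (topRun b m ζ)⁻¹ * staple b m ζ := by
  have htop : ((List.range m).map fun s : ℕ => topTwist b k ζ (site2 ((b : ℤ) + 1) s, 1)) =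
      (List.range m).map fun s : ℕ => ζ (site2 ((b : ℤ) + 1) s, 1) := by
    refine List.map_congr_left fun s _ => ?_
    unfold topTwist; rw [if_neg]; simp
  have hbot : (((List.range m).reverse).map fun s : ℕ => (topTwist b k ζ (site2 0 s, 1))⁻¹) =
      ((List.range m).reverse).map fun s : ℕ => (ζ (site2 0 s, 1))⁻¹ := by
    refine List.map_congr_left fun s _ => ?_
    unfold topTwist; rw [if_neg]; simp
  have hclose : topTwist b k ζ (site2 0 0, 0) = ζ (site2 0 0, 0) := by
    refine topTwist_apply_of_ne k ζ ?_
    simp only [site2_zero]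
    have : (1 : ℤ) ≤ b := by exact_mod_cast hb
    omega
  have hdown : (((List.range (b + 1)).reverse).map fun t : ℕ => (topTwist b k ζ (site2 t m, 0))⁻¹) =
      (k (site2 ((b : ℤ) + 1) m) * (ζ (site2 b m, 0))⁻¹) ::
        (((List.range b).reverse).map fun t : ℕ => (ζ (site2 t m, 0))⁻¹) := by
    rw [List.range_succ, List.reverse_append, List.reverse_singleton, List.singleton_append, List.map_cons]
    congr 1
    · have : topTwist b k ζ (site2 b m, 0) = ζ (site2 b m, 0) * (k (site2 ((b : ℤ) + 1) m))⁻¹ := by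
        have hc : (site2 (b : ℤ) (m : ℤ), (0 : Fin 4)).2 = 0 ∧ (site2 (b : ℤ) (m : ℤ), (0 : Fin 4)).1 0 = (b : ℤ) :=
          ⟨rfl, rfl⟩
        unfold topTwist
        rw [if_pos hc]
        show ζ (site2 b m, 0) * (k (site2 (b : ℤ) (m : ℤ) + Pi.single (0 : Fin 4) 1))⁻¹ = _
        rw [site2_add_single_zero]
      rw [this, mul_inv_rev, inv_inv]
    · refine List.map_congr_left fun t ht => ?_
      rw [topTwist_apply_of_ne k ζ]
      simp only [site2_zero]
      have ht' : t < b := by simpa using ht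
      omega
  have hdown0 : (((List.range (b + 1)).reverse).map fun t : ℕ => (ζ (site2 t m, 0))⁻¹) =
      (ζ (site2 b m, 0))⁻¹ :: (((List.range b).reverse).map fun t : ℕ => (ζ (site2 t m, 0))⁻¹) := by
    rw [List.range_succ, List.reverse_append, List.reverse_singleton, List.singleton_append, List.map_cons]
  unfold staple topRun
  rw [htop, hbot, hclose, hdown, hdown0, List.prod_cons, List.prod_cons]
  set A := ((List.range m).map fun s : ℕ => ζ (site2 ((b : ℤ) + 1) s, 1)).prod
  set R := (((List.range b).reverse).map fun t : ℕ => (ζ (site2 t m, 0))⁻¹).prod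
  set Bt := (((List.range m).reverse).map fun s : ℕ => (ζ (site2 0 s, 1))⁻¹).prod
  group

end Geometry5

end Summit.QuantumFields.YangMills.Cruxes.IR.FixedMeshAllG

end
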